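import Summits.BirchSwinnertonDyer.BirchSwinnertonDyer.Theses.GenusKolyvaginAtTwo

/-!
# Route `GenusKolyvaginAtTwo`, crux #3 `KolyvaginExactAtTwo` (stmt-BirchSwinnertonDyer-22137):
# why the structure argument at `p = 2` must be run over `ℚ` for the pair `(E, E^{(d_K)})`, not
# over `K` — Frobenius squares at inert primes, blindness of the `K_λ`-duality to `τ`-invariant
# `2`-torsion classes, and the index-`2` defects of the eigen-decomposition (helper, PROVED;
# seat `bsd-line-gk2-p2`, line `birth`, second helper file)

The crux ports McCallum's form of Kolyvagin's structure theorem (exact order of `Ш(E/K)[p^∞]` from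
one non-divisible derived point) to `p = 2`. Its engine is the pairing, at a Kolyvagin prime `λ ∣ ℓ`
of `K` (inert `ℓ`, `Frob_ℓ = τ` on `K(E[2^M])`), of the localisation `s_λ` of a Selmer class
`s ∈ Sel_{2^M}(E/K)` against the singular part of a derived class `c_M(ℓ)`, followed by a Čebotarev
choice of `ℓ` making `s_λ` as large as `s`. The first helper file
(`GenusKolyvaginAtTwoKolyvaginExactAtTwoFrobeniusHalves`) isolated the sign-of-`Δ` dichotomy and
the loss of one factor `2` in every eigen–eigen local duality step over `K_λ` (its
`pairing_norm_norm_opposite`). This file isolates, as pure group/module algebra, the three facts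
behind the sharper diagnosis of memo ANALYSIS-22137 v4 (evidence on the item):

* `map_mul_self_conj_eq` (**Frobenius squares at an inert prime are norms, up to a constant**). For
  a group `Γ` (think `Gal(M/ℚ)`), a normal subgroup `N` (think `Gal(M/L)`, `L = K(E[2^M])`), an
  additive `f : N → A` (the restriction of a cocycle `s` to `G_L`, a homomorphism) which is
  `g`-equivariant (`f(g n g⁻¹) = ρ (f n)`, `ρ = ρ_E(g)`) for an element `g` with `g² ∈ N` and `ρ`
  an involution (a lift of complex conjugation, `ρ = ±τ_E`): `f((g n)²) = (f n + ρ (f n)) + f(g²)`.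
  Since the Frobenius of the prime `λ` of `K` under a prime of `M` with `Frob = g n` is `(g n)²`,
  the localisations `s_λ` of ONE class at ALL `τ`-class Kolyvagin primes sweep exactly the coset
  `(1 + ρ)·f(N) + f(g²)` — a set of NORMS shifted by a constant — and never all of `f(N)`. At odd
  `p` (where `s` may be taken in a `τ`-eigenspace and `1 ± τ` is onto the eigenline) this costs
  nothing; at `p = 2` it is the source of every defect below. Degenerate cases recorded:
  `map_mul_self_conj_eq_of_fixed` (`ρ` fixes `f n`: value `2 • f n + f(g²)`) and
  `map_mul_self_conj_eq_of_neg` (`ρ (f n) = - f n`: the value `f(g²)` does not depend on `n` at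
  all — the class is invisible to the Čebotarev choice).
* `pairing_norm_eq_zero_of_two_smul_eq_zero` / `…_of_anti` (**blindness**). For a biadditive
  pairing `W` for which `τ` is (anti-)self-adjoint — the local Tate pairing on `H¹(K_λ, E[2^M])`,
  resp. the Weil pairing — a NORM `a + τ a` of a `2`-torsion element `a` pairs to `0` with EVERY
  `τ`-eigenvector `c` (`τ c = ± c`). Derived classes are `τ`-eigenvectors (Gross 1991 Prop. 5.4,
  whose proof is `2`-integral), and by the previous item a `τ`-INVARIANT class of order `2`
  localises into norms of `2`-torsion elements (`f(N) ⊆ A[2]`, `f(g²)` a norm as well when `g` is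
  an involution). Hence over `K_λ` the duality step of Kolyvagin–McCallum extracts NO condition on
  `H¹(K, E[2])^{τ}` — which contains `Res Sel₂(E/ℚ)`, `Res Sel₂(E^{(d_K)}/ℚ)` and the classes of
  `Ш(E/ℚ)[2]` — from ANY layer of derived classes, at ANY level `M`, for EITHER sign of `Δ_E`.
* `pairing_inv_norm_norm` and its two corollaries (**the factor `2` is `Cor ∘ Res`**). For a
  `τ`-INVARIANT pairing (`W (τ x) (τ y) = W x y`, the local Tate pairing, `Gal(K_λ/ℚ_ℓ)` acting
  trivially on `H²(K_λ, μ) = ℤ/2^M`): `W (a + ε τ a) (b + η τ b) = (1 + εη) W a b + (ε + η) W a (τ b)`;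
  equal signs give `2 • (…)`, opposite signs give `0`. Together with the first file's
  anti-invariant version this says: the pairing of two norms is twice a full pairing — and
  `a ↦ a + τ a` is exactly the restriction `H¹_f(ℚ_ℓ, ·) = Λ/(τ − 1)Λ → H¹_f(K_λ, ·) = Λ`, so the
  lost factor is `[K_λ : ℚ_ℓ] = 2 = Cor ∘ Res`: over `ℚ_ℓ` (pairing `Λ/(τ−1)Λ × Λ^{τ = −1} → R`,
  both free of rank one when `Δ_E < 0`) there is no loss.
* The free model `Λ = R × R` with the swap involution (`T₂E ≅ ℤ₂[C₂]` iff `Δ_E < 0`, first file):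
  `fst_sub_snd_norm` / `fst_sub_snd_antinorm` (the functional `ψ = fst − snd` kills the `+`-line
  and is `2ψ` on anti-norms: the `−`-eigenline has index `2` in the quotient by the `+`-eigenline,
  `Λ/Λ⁺ ≅ R`, whereas `ψ` itself is onto), `exists_eigen_add_eigen_iff` (`Λ⁺ + Λ⁻` is the index-`2`
  sublattice `{(x, y) : 2 ∣ x − y}` — the eigen-decomposition misses exactly one bit),
  `norm_eq_zero_iff_eq_antinorm` (`Ĥ⁻¹(C₂, Λ) = 0`: the restriction `Λ/(τ−1)Λ → Λ`, `a ↦ a + τ a`,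
  is injective — no information is lost in `s_λ` itself, only in the pairing step).

READING FOR THE CRUX (memo v4; nothing below is claimed as a theorem of the tree). Since
`E(K)[2] = 0` under the crux's image hypothesis, inflation–restriction gives
`H¹(ℚ, E[2^M]) ≅ H¹(K, E[2^M])^{τ = +1}` and `H¹(ℚ, E^{(d_K)}[2^M]) ≅ H¹(K, E[2^M])^{τ = −1}`
(at `p = 2` these two subgroups neither span nor intersect trivially); every derived class
`c_M(n)`, being a `τ`-eigenvector of sign `ε_n`, DESCENDS to `ℚ` on the member of sign `ε_n` of the
pair `(E, E^{(d_K)})` — Kolyvagin's own 1989 frame, in which his Theorem B at `l = 2` is proved.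
Over `ℚ_ℓ` the duality step is loss-free; the archimedean error term vanishes iff `Δ_E < 0`
(`H¹(ℝ, Λ) = 0` for the free `ℤ/2^M[C₂]`-module), the `2`-adic one vanishes if `2` splits in `K`,
and the bad primes split by the Heegner hypothesis; what survives is a one-bit Čebotarev blind
spot, the entanglement class generating `H¹(Gal(ℚ(E[2^M])/ℚ), E[2^M]) ≅ ℤ/2` (`M ≥ 2`). So the
port the crux asks for exists, if at all, as a PAIR statement over `ℚ` (orders of `Ш(E/ℚ)[2^∞]`
and `Ш(E^{(d_K)}/ℚ)[2^∞]`) for `Δ_E < 0`, `2` split in `K`, Frobenius-class primes of level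
`≥ M₀ + 2`, followed by the explicit `2`-adic comparison with `Ш(E/K)[2^∞]` (Kramer/Milne, the
currency of crux #4) — not as the typed statement over `K` with congruence-form primes of level
`1` and either sign of `Δ`. BSD is not proved by any of this.

References: [GrossLMS1991] §3 (3.2), Prop. 5.4, Prop. 6.2, §8–§9; [McCallumLMS1991] §3 Prop. 3.1,
§5 Lemma 5.3, Thm. 5.4, Cor. 5.6; [Kolyvagin1989Izv] Thm. B_l (l = 2), §3, Prop. 16.
-/

set_option linter.dupNamespace false

namespace Summit.BirchSwinnertonDyer.BirchSwinnertonDyer.Theorems.GenusExact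

/-! ### Frobenius squares at inert primes: `f((g n)²) = (1 + ρ) f(n) + f(g²)` -/

section FrobSquare

variable {Γ : Type*} [Group Γ] {A : Type*} [AddCommGroup A]

/-- The word identity behind "the Frobenius of an inert prime is a square":
`(g n)(g n) = (g n g⁻¹) · (g² n g⁻²) · g²`. [folklore] -/
theorem mul_self_eq_conj_mul_conj_mul_sq (g n : Γ) :
    (g * n) * (g * n) = (g * n * g⁻¹) * ((g * g) * n * (g * g)⁻¹) * (g * g) := by
  group

/-- **Frobenius squares at an inert prime are norms, up to a constant.** Let `N ⊴ Γ`, let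
`f : Γ → A` be additive on `N`, and let `g ∈ Γ` with `g² ∈ N` act on the values by an additive
involution `ρ`: `f (g n g⁻¹) = ρ (f n)` for `n ∈ N`. Then for every `n ∈ N`,
`f ((g n)²) = (f n + ρ (f n)) + f (g²)`.
(Use: `Γ = Gal(M/ℚ)`, `N = Gal(M/L)` with `L ⊇ K(E[2^M])`, `f` = a `1`-cocycle of `G_K` restricted
to `G_L`, where it is a `G_K`-equivariant homomorphism, `g` a lift of complex conjugation,
`ρ = ρ_E(g) = ± τ_E`; a prime of `K` inert over `ℓ` with `Frob_ℓ = g n` has `Frob_λ = (g n)²`, so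
the localisation `s_λ = f(Frob_λ)` is the norm `(1 + ρ) f(n)` shifted by the constant `f(g²)`.)
[cite: GrossLMS1991, §9 (choice of Kolyvagin primes)] -/
theorem map_mul_self_conj_eq (N : Subgroup Γ) [N.Normal] (f : Γ → A) (ρ : A →+ A) (g : Γ)
    (hmul : ∀ x ∈ N, ∀ y ∈ N, f (x * y) = f x + f y)
    (hconj : ∀ n ∈ N, f (g * n * g⁻¹) = ρ (f n)) (hg : g * g ∈ N)
    (hρ : ∀ a, ρ (ρ a) = a) {n : Γ} (hn : n ∈ N) :
    f ((g * n) * (g * n)) = (f n + ρ (f n)) + f (g * g) := by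
  have h1 : g * n * g⁻¹ ∈ N := Subgroup.Normal.conj_mem inferInstance n hn g
  have h2 : (g * g) * n * (g * g)⁻¹ ∈ N := Subgroup.Normal.conj_mem inferInstance n hn (g * g)
  have h2' : f ((g * g) * n * (g * g)⁻¹) = f n := by
    have : (g * g) * n * (g * g)⁻¹ = g * (g * n * g⁻¹) * g⁻¹ := by group
    rw [this, hconj _ h1, hconj _ hn, hρ]
  rw [mul_self_eq_conj_mul_conj_mul_sq, hmul _ (N.mul_mem h1 h2) _ hg, hmul _ h1 _ h2,
    hconj _ hn, h2']
  abel

/-- **Degenerate case `ρ (f n) = f n`** (e.g. `Δ_E > 0`, `f(n) ∈ E[2]`, on which `τ_E` is the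
identity): `f ((g n)²) = 2 • f n + f (g²)`; if moreover `2 • f n = 0` the value is the constant
`f (g²)` — the first file's "every unramified class dies / is constant at every `τ`-class prime".
[folklore] -/
theorem map_mul_self_conj_eq_of_fixed (N : Subgroup Γ) [N.Normal] (f : Γ → A) (ρ : A →+ A)
    (g : Γ) (hmul : ∀ x ∈ N, ∀ y ∈ N, f (x * y) = f x + f y)
    (hconj : ∀ n ∈ N, f (g * n * g⁻¹) = ρ (f n)) (hg : g * g ∈ N)
    (hρ : ∀ a, ρ (ρ a) = a) {n : Γ} (hn : n ∈ N) (hfix : ρ (f n) = f n) :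
    f ((g * n) * (g * n)) = 2 • f n + f (g * g) := by
  rw [map_mul_self_conj_eq N f ρ g hmul hconj hg hρ hn, hfix, two_nsmul]

/-- **Degenerate case `ρ (f n) = - f n`**: `f ((g n)²) = f (g²)` is INDEPENDENT of `n` — such a
class takes the same value at every prime of the Čebotarev set and cannot be separated from `0`
by the choice of the prime. [folklore] -/
theorem map_mul_self_conj_eq_of_neg (N : Subgroup Γ) [N.Normal] (f : Γ → A) (ρ : A →+ A)
    (g : Γ) (hmul : ∀ x ∈ N, ∀ y ∈ N, f (x * y) = f x + f y)
    (hconj : ∀ n ∈ N, f (g * n * g⁻¹) = ρ (f n)) (hg : g * g ∈ N)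
    (hρ : ∀ a, ρ (ρ a) = a) {n : Γ} (hn : n ∈ N) (hneg : ρ (f n) = -f n) :
    f ((g * n) * (g * n)) = f (g * g) := by
  rw [map_mul_self_conj_eq N f ρ g hmul hconj hg hρ hn, hneg, add_neg_cancel, zero_add]

/-- **When `g` is an involution** (`g² = 1`, e.g. complex conjugation itself in `Gal(M/ℚ)`) the
constant vanishes: `f ((g n)²) = f n + ρ (f n)` is an honest norm. [folklore] -/
theorem map_mul_self_conj_eq_of_sq_eq_one (N : Subgroup Γ) [N.Normal] (f : Γ → A) (ρ : A →+ A)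
    (g : Γ) (hmul : ∀ x ∈ N, ∀ y ∈ N, f (x * y) = f x + f y)
    (hconj : ∀ n ∈ N, f (g * n * g⁻¹) = ρ (f n)) (hg1 : g * g = 1)
    (hρ : ∀ a, ρ (ρ a) = a) {n : Γ} (hn : n ∈ N) :
    f ((g * n) * (g * n)) = f n + ρ (f n) := by
  have hg : g * g ∈ N := by rw [hg1]; exact N.one_mem
  have hf1 : f 1 = 0 := by
    have h := hmul 1 N.one_mem 1 N.one_mem
    rw [mul_one] at h
    -- `h : f 1 = f 1 + f 1`
    exact add_left_cancel (a := f 1) (by rw [add_zero]; exact h.symm)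
  rw [map_mul_self_conj_eq N f ρ g hmul hconj hg hρ hn, hg1, hf1, add_zero]

end FrobSquare

/-! ### Blindness: norms of `2`-torsion elements pair trivially with every `τ`-eigenvector -/

section Blindness

variable {A Z : Type*} [AddCommGroup A] [AddCommGroup Z] (W : A →+ A →+ Z) (τ : A →+ A)

/-- **Blindness lemma (self-adjoint `τ`).** If `τ` is self-adjoint for the biadditive pairing `W`
(`W (τ a) b = W a (τ b)` — e.g. a `τ`-invariant pairing with `τ` an involution,
`adjoint_of_invariant`), then for every `2`-torsion element `a` and every `τ`-eigenvector `c`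
(`τ c = c` or `τ c = - c`): `W (a + τ a) c = 0`. (Use: `W` = local Tate pairing on
`H¹(K_λ, E[2^M])`, `a + τ a` = the localisation of a `τ`-invariant class of order `2`
(`map_mul_self_conj_eq_of_sq_eq_one`), `c` = the singular part of a derived class, a
`τ`-eigenvector by Gross 1991 Prop. 5.4: the duality step yields nothing.) [folklore] -/
theorem pairing_norm_eq_zero_of_two_smul_eq_zero (hadj : ∀ a b, W (τ a) b = W a (τ b))
    {a c : A} (h2 : 2 • a = 0) (hc : τ c = c ∨ τ c = -c) : W (a + τ a) c = 0 := by
  have h2W : W a c + W a c = 0 := by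
    rw [← AddMonoidHom.add_apply, ← map_add, ← two_nsmul, h2, map_zero, AddMonoidHom.zero_apply]
  rw [map_add, AddMonoidHom.add_apply, hadj]
  rcases hc with hc | hc
  · rw [hc, h2W]
  · rw [hc, map_neg, add_neg_cancel]

/-- **Blindness lemma (anti-self-adjoint `τ`).** The same conclusion when
`W (τ a) b = - W a (τ b)` (e.g. the Weil pairing, on whose values `τ` acts by `−1`, first file's
`pairing_norm_norm`). [folklore] -/
theorem pairing_norm_eq_zero_of_two_smul_eq_zero_of_anti (hadj : ∀ a b, W (τ a) b = -W a (τ b))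
    {a c : A} (h2 : 2 • a = 0) (hc : τ c = c ∨ τ c = -c) : W (a + τ a) c = 0 := by
  have h2W : W a c + W a c = 0 := by
    rw [← AddMonoidHom.add_apply, ← map_add, ← two_nsmul, h2, map_zero, AddMonoidHom.zero_apply]
  rw [map_add, AddMonoidHom.add_apply, hadj]
  rcases hc with hc | hc
  · rw [hc, add_neg_cancel]
  · rw [hc, map_neg, neg_neg, h2W]

/-- A `τ`-invariant pairing with `τ` an involution has `τ` self-adjoint:
`W (τ a) b = W (τ a) (τ (τ b)) = W a (τ b)`. [folklore] -/
theorem adjoint_of_invariant (hW : ∀ x y, W (τ x) (τ y) = W x y) (hτ : ∀ x, τ (τ x) = x)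
    (a b : A) : W (τ a) b = W a (τ b) := by
  conv_lhs => rw [← hτ b]
  rw [hW]

/-- A `τ`-anti-invariant pairing with `τ` an involution has `τ` anti-self-adjoint. [folklore] -/
theorem anti_adjoint_of_anti_invariant (hW : ∀ x y, W (τ x) (τ y) = -W x y)
    (hτ : ∀ x, τ (τ x) = x) (a b : A) : W (τ a) b = -W a (τ b) := by
  conv_lhs => rw [← hτ b]
  rw [hW]

end Blindness

/-! ### Invariant pairings of norms: the factor `2` is `Cor ∘ Res` -/

section InvariantPairing

variable {A Z : Type*} [AddCommGroup A] [AddCommGroup Z] (W : A →+ A →+ Z) (τ : A →+ A)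

/-- **Norms under a `τ`-INVARIANT pairing** (the local Tate pairing on `H¹(K_λ, E[2^M])`, on whose
target `ℤ/2^M = H²(K_λ, μ_{2^M})` the group `Gal(K_λ/ℚ_ℓ) = ⟨τ⟩` acts trivially). For an involution
`τ` with `W (τ x) (τ y) = W x y` and all integers `ε, η`:
`W (a + ε • τ a) (b + η • τ b) = (1 + ε * η) • W a b + (ε + η) • W a (τ b)`.
Companion of the first file's anti-invariant `pairing_norm_norm`. [cite: McCallumLMS1991, §5 Lemma 5.3] -/
theorem pairing_inv_norm_norm (hW : ∀ x y, W (τ x) (τ y) = W x y) (hτ : ∀ x, τ (τ x) = x)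
    (ε η : ℤ) (a b : A) :
    W (a + ε • τ a) (b + η • τ b) = (1 + ε * η) • W a b + (ε + η) • W a (τ b) := by
  have h1 : W (τ a) b = W a (τ b) := adjoint_of_invariant W τ hW hτ a b
  have h2 : W (τ a) (τ b) = W a b := hW a b
  simp only [map_add, map_zsmul, AddMonoidHom.add_apply, AddMonoidHom.zsmul_apply, h1, h2]
  module

/-- **Equal signs pair into `2 • (…)`** (`η = ε`, `ε² = 1`): `W (a + ε τ a) (b + ε τ b) =
2 • (W a b + ε • W a (τ b))`. The cofactor `W a b + ε W a (τ b) = W a (b + ε τ b)` is the pairing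
of the class `a` over `ℚ_ℓ` (coinvariants `Λ/(τ − ε)Λ`) with the norm class; the `2` is
`[K_λ : ℚ_ℓ] = Cor ∘ Res`: `⟨Res a, Res b⟩_{K_λ} = 2 ⟨a, b⟩_{ℚ_ℓ}`. At odd `p` a unit, at `p = 2`
the one lost bit of memo §8 — recovered by pairing over `ℚ_ℓ`. [cite: McCallumLMS1991, §5 Lemma 5.3] -/
theorem pairing_inv_norm_norm_same (hW : ∀ x y, W (τ x) (τ y) = W x y) (hτ : ∀ x, τ (τ x) = x)
    {ε : ℤ} (hε : ε * ε = 1) (a b : A) :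
    W (a + ε • τ a) (b + ε • τ b) = 2 • (W a b + ε • W a (τ b)) := by
  rw [pairing_inv_norm_norm W τ hW hτ, hε]
  module

/-- **Opposite signs are orthogonal** (`η = −ε`, `ε² = 1`) for an invariant pairing:
`W (a + ε τ a) (b − ε τ b) = 0` — the `+`-norms and the `−`-norms are mutually orthogonal, so a
class localising into `Λ^{ε₀}` is never constrained by a singular part in `Λ^{−ε₀}`.
[cite: McCallumLMS1991, §5 Lemma 5.3] -/
theorem pairing_inv_norm_norm_opposite (hW : ∀ x y, W (τ x) (τ y) = W x y)
    (hτ : ∀ x, τ (τ x) = x) {ε : ℤ} (hε : ε * ε = 1) (a b : A) :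
    W (a + ε • τ a) (b + (-ε) • τ b) = 0 := by
  rw [pairing_inv_norm_norm W τ hW hτ, mul_neg, hε]
  module

end InvariantPairing

/-! ### The free model `Λ = R × R` with the swap (`Δ_E < 0`): what the eigen-decomposition misses -/

section FreeModel

variable {R : Type*} [CommRing R]

/-- In the free `R[C₂]`-module `R × R` (swap involution; `T₂E ⊗ ℤ/2^M` when `Δ_E < 0`), the
functional `ψ(x, y) = x − y` — the identification `Λ/Λ⁺ ≅ R`, `Λ⁺` the diagonal — vanishes on
every norm `v + τ v`. [folklore] -/
theorem fst_sub_snd_norm (v : R × R) :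
    (v + (AddEquiv.prodComm : R × R ≃+ R × R) v).1 -
      (v + (AddEquiv.prodComm : R × R ≃+ R × R) v).2 = 0 := by
  simp only [Prod.fst_add, Prod.snd_add, AddEquiv.coe_prodComm, Prod.fst_swap, Prod.snd_swap]
  ring

/-- … and is `2ψ` on every anti-norm `v − τ v`: `ψ(v − τ v) = 2 (v.1 − v.2)`. So the
`−`-eigenline `(1 − τ)Λ` has image `2R` — index `2` — in the quotient `Λ/Λ⁺ ≅ R`, although `ψ`
itself is onto: projecting a class to the `−`-eigenline before measuring it in `Λ/Λ⁺` loses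
exactly one bit, measuring it directly in the quotient loses nothing. This is the module-theoretic
content of "use `Λ/Λ^{ε₀}`, not `Λ^{−ε₀}`" in memo v4. [folklore] -/
theorem fst_sub_snd_antinorm (v : R × R) :
    (v - (AddEquiv.prodComm : R × R ≃+ R × R) v).1 -
      (v - (AddEquiv.prodComm : R × R ≃+ R × R) v).2 = 2 * (v.1 - v.2) := by
  simp only [Prod.fst_sub, Prod.snd_sub, AddEquiv.coe_prodComm, Prod.fst_swap, Prod.snd_swap]
  ring

/-- **`Λ⁺ + Λ⁻` is the index-`2` sublattice `{2 ∣ x − y}`.** An element of `R × R` is a sum of a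
`+`-eigenvector `(s, s)` and a `−`-eigenvector `(t, −t)` iff `x − y` is divisible by `2`. At odd
`p` (`2 ∈ R^×`) this is everything — the eigen-decomposition `Λ = Λ⁺ ⊕ Λ⁻` of McCallum §5 (5.1);
at `p = 2` it misses one bit per free summand. [folklore] -/
theorem exists_eigen_add_eigen_iff (v : R × R) :
    (∃ s t : R, v = (s + t, s - t)) ↔ ∃ t : R, v.1 - v.2 = 2 * t := by
  constructor
  · rintro ⟨s, t, rfl⟩
    exact ⟨t, by ring⟩
  · rintro ⟨t, ht⟩
    refine ⟨v.1 - t, t, ?_⟩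
    ext
    · simp
    · simp only
      linear_combination -ht

/-- **`Ĥ⁻¹(C₂, Λ) = 0` for the free module**: a vector with zero norm is an anti-norm,
`v + τ v = 0 ↔ v = (v.1, 0) − τ (v.1, 0)`. Equivalently the norm map
`Λ/(τ − 1)Λ → Λ`, `[v] ↦ v + τ v` — the restriction `H¹_f(ℚ_ℓ, E[2^M]) → H¹_f(K_λ, E[2^M])` at an
inert Kolyvagin prime — is INJECTIVE: the localisation `s_λ` of a class coming from `ℚ` still
carries all of `s_ℓ`; the bit is lost only in the pairing step (`pairing_inv_norm_norm_same`).
[folklore] -/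
theorem norm_eq_zero_iff_eq_antinorm (v : R × R) :
    v + (AddEquiv.prodComm : R × R ≃+ R × R) v = 0 ↔
      v = ((v.1, 0) : R × R) - (AddEquiv.prodComm : R × R ≃+ R × R) (v.1, 0) := by
  obtain ⟨x, y⟩ := v
  simp only [AddEquiv.coe_prodComm, Prod.swap_prod_mk, Prod.mk_add_mk, Prod.mk_sub_mk,
    Prod.mk_eq_zero, sub_zero, zero_sub, Prod.mk.injEq, true_and]
  constructor
  · rintro ⟨h, -⟩
    linear_combination h
  · intro h
    refine ⟨by rw [h, add_neg_cancel], by rw [h, neg_add_cancel]⟩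

/-- **`Ĥ⁰(C₂, Λ) = 0` for the free module, quotient form**: the norm map from the coinvariants
`Λ/(τ − 1)Λ ≅ R` (via `(x, y) ↦ x + y`) onto the invariants `Λ⁺` (the diagonal) is the bijection
`r ↦ (r, r)`: `v + τ v = (v.1 + v.2, v.1 + v.2)`. With `norm_eq_zero_iff_eq_antinorm`: over `ℚ_ℓ`
the finite part `E(ℚ_ℓ)/2^M ≅ Λ/(τ − 1)Λ` is free of rank one over `R = ℤ/2^M` and restriction
identifies it with `Λ⁺`. [folklore] -/
theorem norm_eq_diag (v : R × R) :
    v + (AddEquiv.prodComm : R × R ≃+ R × R) v = (v.1 + v.2, v.1 + v.2) := by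
  obtain ⟨x, y⟩ := v
  simp only [AddEquiv.coe_prodComm, Prod.swap_prod_mk, Prod.mk_add_mk, Prod.mk.injEq, true_and]
  ring

end FreeModel

/-! ### Descent of eigenclasses: restriction to an index-`2` subgroup is injective when there are
no invariants (appended, same seat) -/

section Descent

open CategoryTheory CategoryTheory.Limits groupCohomology

universe u

variable {k G : Type u} [CommRing k] [Group G]

/-- A representation with at most one vector is a zero object of `Rep k G`. [folklore] -/
theorem isZero_rep_of_subsingleton {H : Type u} [Group H] (X : Rep k H) [Subsingleton X] :
    IsZero X := by
  rw [IsZero.iff_id_eq_zero]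
  ext x
  exact Subsingleton.elim _ _

/-- **Descent, injectivity half (memo v4 §9.1).** For a normal subgroup `S ⊴ G` and a
`G`-representation `A` WITHOUT non-zero `S`-invariants (`A^S = 0`), the restriction
`Res : H¹(G, A) → H¹(S, A)` is injective — from Mathlib's inflation–restriction sequence
`0 → H¹(G⧸S, A^S) → H¹(G, A) → H¹(S, A)` (`groupCohomology.H1InfRes_exact`), whose first term
vanishes. (Use: `G = Gal(\bar ℚ/ℚ)` or a finite quotient, `S = G_K` of index `2`, `A = E[2^M]` or
`E^{(d_K)}[2^M]`, `A^S = E(K)[2^M] = 0` under the crux's image hypothesis: the classes over `ℚ` on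
the two members of the pair `(E, E^{(d_K)})` embed into `H¹(K, E[2^M])`, onto `τ`-eigenvectors of
sign `+1`, resp. `−1`; this is the frame in which Kolyvagin proves Theorem B₂.) [folklore] -/
theorem res_H1_injective_of_forall_invariant_eq_zero (A : Rep k G) (S : Subgroup G) [S.Normal]
    (hS : ∀ a : A, (∀ s : G, s ∈ S → A.ρ s a = a) → a = 0) :
    Function.Injective (H1InfRes A S).g := by
  haveI : Subsingleton (A.quotientToInvariants S) := by
    refine ⟨fun x y => Subtype.ext ?_⟩
    have hx : (x : A) = 0 := hS x (fun s hs => x.2 ⟨s, hs⟩)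
    have hy : (y : A) = 0 := hS y (fun s hs => y.2 ⟨s, hs⟩)
    rw [hx, hy]
  have h1 : IsZero (H1InfRes A S).X₁ :=
    (functor k (G ⧸ S) 1).map_isZero (isZero_rep_of_subsingleton _)
  have hf : (H1InfRes A S).f = 0 := h1.eq_of_src _ _
  have : Mono (H1InfRes A S).g := (H1InfRes_exact A S).mono_g hf
  exact (ModuleCat.mono_iff_injective _).mp this

end Descent

end Summit.BirchSwinnertonDyer.BirchSwinnertonDyer.Theorems.GenusExact
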